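import Summits.CriticalPhenomena.PercolationContinuityZ3.Theorems.PercNearOneGluingNoHeavyLowerTailSahiCTCLadderRowOneStep
import HarnessLib

/-!
# `NoHeavyLowerTail` (crux stmt-CriticalPhenomena-4575), P3 lane: the row with one doubled point of the ladder inequality — base cases and induction
# (memo g25 §3 (v))

Support file (seat `prim-l12-p3`, gen 25; `--supports stmt-CriticalPhenomena-4575`).  For 2-live up-sets `𝒳, 𝒵`, a point `d` and a finset `T ∌ d`
(`t = #T`, `N = cnbrs(d)` the common neighbours of `d` in `T`, `W(T)` = common 2-sets inside `T`):
    `[t ≥ 3]·((t+1)·#N + #W(T)) + [t = 2]·#N  ≤  Σ_{y ∈ T} κ(∅, d ∪ T−y) + Σ_{E ∈ C(T,2)} κ({d}, T \ E)`   (`rowOne_le`),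
by induction on `t` with the step of `…SahiCTCLadderRowOneStep` and the base cases `t = 2, 3` (`rowOne_base_two`, `rowOne_base_three`).
Nothing is asserted about the crux.
-/

namespace Summit.CriticalPhenomena.PercolationContinuityZ3.Theorems.SahiCTCForms

open Finset

variable {α : Type*} [DecidableEq α]

section RowOneBase
variable {𝒳 𝒵 : Finset (Finset α)} {d : α}

/-- Base `t = 2`: `#N ≤ Σ_{y ∈ T} κ(∅, d ∪ T − y)`. [this work] -/
theorem rowOne_base_two (hX2 : ∀ U ∈ 𝒳, 2 ≤ #U) (hZ2 : ∀ U ∈ 𝒵, 2 ≤ #U) {T : Finset α} (hdT : d ∉ T) (hT : #T = 2) :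
    (#(cnbrs 𝒳 𝒵 (insert d T) d) : ℤ) ≤ ∑ y ∈ T, kap 𝒳 𝒵 ∅ (insert d (T.erase y)) := by
  obtain ⟨y₁, y₂, hne, rfl⟩ := card_eq_two.1 hT
  have hd1 : d ≠ y₁ := fun h => hdT (by rw [h]; simp)
  have hd2 : d ≠ y₂ := fun h => hdT (by rw [h]; simp)
  have e1 : insert d (({y₁, y₂} : Finset α).erase y₁) = {d, y₂} := by
    rw [erase_insert (by rwa [mem_singleton])]
  have e2 : insert d (({y₁, y₂} : Finset α).erase y₂) = {d, y₁} := by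
    rw [pair_comm, erase_insert (by rw [mem_singleton]; exact hne.symm)]
  rw [sum_pair hne, e1, e2, kap_empty_pair_eq hX2 hZ2 (card_pair hd2), kap_empty_pair_eq hX2 hZ2 (card_pair hd1)]
  unfold cnbrs
  rw [erase_insert hdT, filter_insert, filter_singleton]
  by_cases h1 : ({d, y₁} : Finset α) ∈ 𝒳 ∧ ({d, y₁} : Finset α) ∈ 𝒵 <;>
    by_cases h2 : ({d, y₂} : Finset α) ∈ 𝒳 ∧ ({d, y₂} : Finset α) ∈ 𝒵 <;>
    simp [h1, h2, hne]

/-- On the 3-point cube `d ∪ T − y` (`#T = 3`, `y ∈ T`): three disjoint kinds of common members. [this work] -/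
theorem card_tr_inter_three {T : Finset α} (hdT : d ∉ T) (hT : #T = 3) {y : α} (hy : y ∈ T) :
    (#(((cnbrs 𝒳 𝒵 (insert d T) d).erase y)) : ℤ)
      + (if T.erase y ∈ 𝒳 ∧ T.erase y ∈ 𝒵 then 1 else 0)
      + (if insert d (T.erase y) ∈ 𝒳 ∧ insert d (T.erase y) ∈ 𝒵 then 1 else 0)
      ≤ #(tr 𝒳 ∅ (insert d (T.erase y)) ∩ tr 𝒵 ∅ (insert d (T.erase y))) := by
  set S := insert d (T.erase y) with hS
  set F1 := ((cnbrs 𝒳 𝒵 (insert d T) d).erase y).image fun u => ({d, u} : Finset α) with hF1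
  set F2 : Finset (Finset α) := if T.erase y ∈ 𝒳 ∧ T.erase y ∈ 𝒵 then {T.erase y} else ∅ with hF2
  set F3 : Finset (Finset α) := if S ∈ 𝒳 ∧ S ∈ 𝒵 then {S} else ∅ with hF3
  have hdTy : d ∉ T.erase y := fun h => hdT (mem_of_mem_erase h)
  have hcS : #S = 3 := by rw [hS, card_insert_of_notMem hdTy, card_erase_of_mem hy, hT]
  have hcTy : #(T.erase y) = 2 := by rw [card_erase_of_mem hy, hT]
  have hsub : F1 ∪ F2 ∪ F3 ⊆ tr 𝒳 ∅ S ∩ tr 𝒵 ∅ S := by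
    intro A hA
    rcases mem_union.1 hA with h12 | h3
    · rcases mem_union.1 h12 with h1 | h2
      · obtain ⟨u, hu, rfl⟩ := mem_image.1 h1
        obtain ⟨huy, huN⟩ := mem_erase.1 hu
        obtain ⟨huT, hX, hZ⟩ := (mem_cnbrs_insert hdT).1 huN
        have hsub : ({d, u} : Finset α) ⊆ S := insert_subset (mem_insert_self _ _) (singleton_subset_iff.2
          (mem_insert_of_mem (mem_erase.2 ⟨huy, huT⟩)))
        exact mem_inter.2 ⟨mem_tr_empty.2 ⟨hsub, hX⟩, mem_tr_empty.2 ⟨hsub, hZ⟩⟩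
      · rw [hF2] at h2; split_ifs at h2 with h
        · rw [mem_singleton] at h2; subst h2
          exact mem_inter.2 ⟨mem_tr_empty.2 ⟨subset_insert _ _, h.1⟩, mem_tr_empty.2 ⟨subset_insert _ _, h.2⟩⟩
        · exact absurd h2 (notMem_empty _)
    · rw [hF3] at h3; split_ifs at h3 with h
      · rw [mem_singleton] at h3; subst h3
        exact mem_inter.2 ⟨mem_tr_empty.2 ⟨Subset.rfl, h.1⟩, mem_tr_empty.2 ⟨Subset.rfl, h.2⟩⟩
      · exact absurd h3 (notMem_empty _)
  have hF1d : ∀ A ∈ F1, d ∈ A ∧ #A = 2 := fun A hA => by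
    obtain ⟨u, hu, rfl⟩ := mem_image.1 hA
    have hud : d ≠ u := fun h => hdT (h ▸ ((mem_cnbrs_insert hdT).1 (mem_of_mem_erase hu)).1)
    exact ⟨by simp, card_pair hud⟩
  have hd12 : Disjoint F1 F2 := by
    rw [hF2]; split_ifs
    · rw [disjoint_singleton_right]; exact fun h => hdTy (hF1d _ h).1
    · exact disjoint_empty_right _
  have hd3 : Disjoint (F1 ∪ F2) F3 := by
    rw [hF3]; split_ifs
    · rw [disjoint_singleton_right, mem_union, not_or]
      refine ⟨fun h => ?_, fun h => ?_⟩
      · have := (hF1d _ h).2; omega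
      · rw [hF2] at h; split_ifs at h
        · rw [mem_singleton] at h
          have : #S = 2 := by rw [h]; exact hcTy
          omega
        · exact notMem_empty _ h
    · exact disjoint_empty_right _
  have hcard := card_le_card hsub
  rw [card_union_of_disjoint hd3, card_union_of_disjoint hd12, card_image_of_injOn] at hcard
  · have c2 : (#F2 : ℤ) = if T.erase y ∈ 𝒳 ∧ T.erase y ∈ 𝒵 then 1 else 0 := by rw [hF2]; split_ifs <;> simp
    have c3 : (#F3 : ℤ) = if S ∈ 𝒳 ∧ S ∈ 𝒵 then 1 else 0 := by rw [hF3]; split_ifs <;> simp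
    rw [← c2, ← c3]; exact_mod_cast hcard
  · intro u hu u' hu' h
    have hud : u ≠ d := fun hh => hdT (hh ▸ ((mem_cnbrs_insert hdT).1 (mem_of_mem_erase (Finset.mem_coe.1 hu))).1)
    have h' : ({d, u} : Finset α) = {d, u'} := h
    have : u ∈ ({d, u'} : Finset α) := by rw [← h']; simp
    simp only [mem_insert, mem_singleton] at this
    rcases this with h1 | h1
    · exact absurd h1 hud
    · exact h1

/-- Base `t = 3`: `4·#N + #W(T) ≤ lhs`. [this work] -/
theorem rowOne_base_three (h𝒳 : IsUpperSet (𝒳 : Set (Finset α))) (h𝒵 : IsUpperSet (𝒵 : Set (Finset α)))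
    (hX2 : ∀ U ∈ 𝒳, 2 ≤ #U) (hZ2 : ∀ U ∈ 𝒵, 2 ≤ #U) {T : Finset α} (hdT : d ∉ T) (hT : #T = 3) :
    (4 : ℤ) * #(cnbrs 𝒳 𝒵 (insert d T) d) + #(cedges 𝒳 𝒵 T) ≤
      ∑ y ∈ T, kap 𝒳 𝒵 ∅ (insert d (T.erase y)) + ∑ E ∈ T.powersetCard 2, kap 𝒳 𝒵 {d} (T \ E) := by
  set N := cnbrs 𝒳 𝒵 (insert d T) d with hN
  have hNT : N ⊆ T := fun y hy => ((mem_cnbrs_insert hdT).1 hy).1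
  have hdX : ({d} : Finset α) ∉ 𝒳 := fun h => by have := hX2 _ h; simp at this
  have hdZ : ({d} : Finset α) ∉ 𝒵 := fun h => by have := hZ2 _ h; simp at this
  -- (1) the based cubes are single points: Σ_E κ({d}, T \ E) = Σ_y κ({d}, {y}) ≥ #N
  have h1 : (#N : ℤ) ≤ ∑ E ∈ T.powersetCard 2, kap 𝒳 𝒵 {d} (T \ E) := by
    rw [sum_powersetCard_sdiff T (by omega) _, hT, show 3 - 2 = 1 from rfl, sum_powersetCard_one]
    have hb := card_sub_le_sum (S := T) (X := T.filter fun y => y ∉ N) (f := fun y => kap 𝒳 𝒵 {d} {y})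
      (fun y hy => kap_nonneg h𝒳 h𝒵 _ _ (by
        rw [disjoint_singleton_left, mem_singleton]; exact fun h => hdT (h ▸ hy)))
      (fun y hy hyX => by
        have hyN : y ∈ N := by by_contra h; exact hyX (mem_filter.2 ⟨hy, h⟩)
        obtain ⟨_, hX, hZ⟩ := (mem_cnbrs_insert hdT).1 hyN
        rw [pair_comm] at hX hZ
        exact one_le_kap_of_loop h𝒳 h𝒵 hdX hdZ (mem_singleton_self y) hX hZ)
    have hc : #(T.filter fun y => y ∉ N) + #N = #T := by
      have := card_filter_add_card_filter_not (s := T) (fun y => y ∉ N)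
      rw [show (T.filter fun y => ¬ y ∉ N) = N from by
        ext y; simp only [mem_filter, not_not]; exact ⟨fun h => h.2, fun h => ⟨hNT h, h⟩⟩] at this
      exact this
    have : (#T : ℤ) - #(T.filter fun y => y ∉ N) = #N := by
      have := congrArg (fun x : ℕ => (x : ℤ)) hc; push_cast at this; linarith
    linarith
  -- (2) the restriction cubes
  have h2 : ∀ y ∈ T, (#(N.erase y) : ℤ) + (if T.erase y ∈ 𝒳 ∧ T.erase y ∈ 𝒵 then 1 else 0)
      + (if insert d (T.erase y) ∈ 𝒳 ∧ insert d (T.erase y) ∈ 𝒵 then 1 else 0)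
      ≤ kap 𝒳 𝒵 ∅ (insert d (T.erase y)) := fun y hy => by
    rw [kap_empty_eq_card_of_card_le_three hX2 hZ2 (by
      rw [card_insert_of_notMem (fun h => hdT (mem_of_mem_erase h)), card_erase_of_mem hy, hT])]
    exact card_tr_inter_three hdT hT hy
  have h2s := sum_le_sum h2
  rw [sum_add_distrib, sum_add_distrib] at h2s
  -- (2a) Σ_y #(N − y) = 3#N − #N
  have h2a : ∑ y ∈ T, (#(N.erase y) : ℤ) = 2 * #N := by
    have : ∀ y ∈ T, (#(N.erase y) : ℤ) = #N - if y ∈ N then 1 else 0 := fun y hy => by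
      split_ifs with h
      · rw [card_erase_of_mem h]; have := card_pos.2 ⟨y, h⟩; push_cast [Nat.cast_sub this]; ring
      · rw [erase_eq_of_notMem h]; ring
    rw [sum_congr rfl this, sum_sub_distrib, sum_const, nsmul_eq_mul, hT, sum_boole, filter_mem_eq_inter,
      inter_eq_right.2 hNT]
    push_cast; ring
  -- (2b) Σ_y [T − y common] ≥ #W(T): every common edge inside T is T − y for its missing point y
  have h2b : (#(cedges 𝒳 𝒵 T) : ℤ) ≤ ∑ y ∈ T, (if T.erase y ∈ 𝒳 ∧ T.erase y ∈ 𝒵 then (1 : ℤ) else 0) := by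
    rw [← Finset.sum_filter, sum_const, nsmul_eq_mul, mul_one]
    have : #(cedges 𝒳 𝒵 T) ≤ #(T.filter fun y => T.erase y ∈ 𝒳 ∧ T.erase y ∈ 𝒵) := by
      refine card_le_card_of_surjOn (fun y => T.erase y) fun e he => ?_
      obtain ⟨heT, he2, hX, hZ⟩ := mem_cedges.1 (Finset.mem_coe.1 he)
      -- the missing point
      have : (T \ e).Nonempty := by rw [← card_pos, card_sdiff_of_subset heT, hT, he2]; norm_num
      obtain ⟨y, hy⟩ := this
      have hTe : T.erase y = e := by
        refine (eq_of_subset_of_card_le (fun x hx => mem_erase.2 ⟨fun h => (mem_sdiff.1 hy).2 (by rw [← h]; exact hx), heT hx⟩) ?_).symm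
        rw [card_erase_of_mem (mem_sdiff.1 hy).1, hT, he2]
      refine ⟨y, Finset.mem_coe.2 (mem_filter.2 ⟨(mem_sdiff.1 hy).1, ?_⟩), hTe⟩
      rw [hTe]; exact ⟨hX, hZ⟩
    exact_mod_cast this
  -- (2c) Σ_y [d ∪ T − y common] ≥ #N
  have h2c : (#N : ℤ) ≤ ∑ y ∈ T, (if insert d (T.erase y) ∈ 𝒳 ∧ insert d (T.erase y) ∈ 𝒵 then (1 : ℤ) else 0) := by
    -- a point y such that some OTHER point of T is a common neighbour of d gets 1
    have key : ∀ y ∈ T, (∃ u ∈ T.erase y, u ∈ N) → (insert d (T.erase y) ∈ 𝒳 ∧ insert d (T.erase y) ∈ 𝒵) := by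
      intro y hy ⟨u, hu, huN⟩
      obtain ⟨_, hX, hZ⟩ := (mem_cnbrs_insert hdT).1 huN
      have hsub : ({d, u} : Finset α) ⊆ insert d (T.erase y) := insert_subset (mem_insert_self _ _)
        (singleton_subset_iff.2 (mem_insert_of_mem hu))
      exact ⟨h𝒳 hsub hX, h𝒵 hsub hZ⟩
    by_cases hN0 : N = ∅
    · rw [hN0, card_empty, Nat.cast_zero]
      exact sum_nonneg fun y _ => by split_ifs <;> norm_num
    obtain ⟨n, hn⟩ := nonempty_iff_ne_empty.2 hN0
    have hnT : n ∈ T := hNT hn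
    have hb := card_sub_le_sum (S := T) (X := if 2 ≤ #N then ∅ else {n})
      (f := fun y => if insert d (T.erase y) ∈ 𝒳 ∧ insert d (T.erase y) ∈ 𝒵 then (1 : ℤ) else 0)
      (fun y _ => by split_ifs <;> norm_num)
      (fun y hy hyX => by
        rw [if_pos (key y hy ?_)]
        split_ifs at hyX with h2
        · -- two common neighbours: one of them differs from y
          obtain ⟨u, u', hu, hu', huu'⟩ := one_lt_card_iff.1 h2
          by_cases huy : u = y
          · exact ⟨u', mem_erase.2 ⟨fun h => huu' (huy.trans h.symm), hNT hu'⟩, hu'⟩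
          · exact ⟨u, mem_erase.2 ⟨huy, hNT hu⟩, hu⟩
        · rw [mem_singleton] at hyX
          exact ⟨n, mem_erase.2 ⟨fun h => hyX h.symm, hnT⟩, hn⟩)
    beta_reduce at hb
    split_ifs at hb with h2
    · rw [card_empty, Nat.cast_zero, sub_zero, hT] at hb
      push_cast at hb
      have : (#N : ℤ) ≤ 3 := by exact_mod_cast (card_le_card hNT).trans hT.le
      linarith
    · rw [card_singleton, hT] at hb
      have : (#N : ℤ) ≤ 1 := by exact_mod_cast (by omega : #N ≤ 1)
      push_cast at hb; linarith
  linarith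

/-- **Row (v) in Kleitman-surplus form** (memo g25 §3 (v)): for 2-live up-sets, `d ∉ T`, `t = #T`, `N` = common neighbours of `d` in `T`, `W(T)` =
common 2-sets inside `T`:
`[t ≥ 3]·((t+1)·#N + #W(T)) + [t = 2]·#N ≤ Σ_{y∈T} κ(∅, d ∪ T − y) + Σ_{E ∈ C(T,2)} κ({d}, T \ E)`. [this work] -/
theorem rowOne_le (h𝒳 : IsUpperSet (𝒳 : Set (Finset α))) (h𝒵 : IsUpperSet (𝒵 : Set (Finset α)))
    (hX2 : ∀ U ∈ 𝒳, 2 ≤ #U) (hZ2 : ∀ U ∈ 𝒵, 2 ≤ #U) :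
    ∀ (n : ℕ) (T : Finset α), #T = n → d ∉ T →
      (if 3 ≤ #T then ((#T : ℤ) + 1) * #(cnbrs 𝒳 𝒵 (insert d T) d) + #(cedges 𝒳 𝒵 T)
        else if #T = 2 then (#(cnbrs 𝒳 𝒵 (insert d T) d) : ℤ) else 0)
      ≤ ∑ y ∈ T, kap 𝒳 𝒵 ∅ (insert d (T.erase y)) + ∑ E ∈ T.powersetCard 2, kap 𝒳 𝒵 {d} (T \ E) := by
  intro n
  induction n using Nat.strong_induction_on with
  | _ n ih =>
  intro T hTn hdT
  have hnn1 : 0 ≤ ∑ y ∈ T, kap 𝒳 𝒵 ∅ (insert d (T.erase y)) :=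
    sum_nonneg fun y _ => kap_nonneg h𝒳 h𝒵 _ _ (disjoint_empty_left _)
  have hnn2 : 0 ≤ ∑ E ∈ T.powersetCard 2, kap 𝒳 𝒵 {d} (T \ E) :=
    sum_nonneg fun E _ => kap_nonneg h𝒳 h𝒵 _ _ (by
      rw [disjoint_singleton_left]; exact fun h => hdT (mem_sdiff.1 h).1)
  by_cases h3 : 3 ≤ #T
  swap
  · rw [if_neg h3]
    by_cases h2 : #T = 2
    · rw [if_pos h2]; linarith [rowOne_base_two (𝒳 := 𝒳) (𝒵 := 𝒵) hX2 hZ2 hdT h2]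
    · rw [if_neg h2]; linarith
  rw [if_pos h3]
  by_cases h4 : 4 ≤ #T
  swap
  · have hT3 : #T = 3 := by omega
    have := rowOne_base_three h𝒳 h𝒵 hX2 hZ2 hdT hT3
    rw [hT3]; push_cast; linarith
  -- the step
  obtain ⟨y₀, hy₀, hstep⟩ := step_bound h𝒳 h𝒵 hX2 hZ2 hdT h4
  have hT' : #(T.erase y₀) = n - 1 := by rw [card_erase_of_mem hy₀, hTn]
  have hIH := ih (n - 1) (by omega) (T.erase y₀) hT' (fun h => hdT (mem_of_mem_erase h))
  rw [if_pos (by omega : 3 ≤ #(T.erase y₀)), hT'] at hIH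
  have hlhs := lhs_step h𝒳 h𝒵 (𝒳 := 𝒳) (𝒵 := 𝒵) hdT hy₀
  have e : ((n - 1 : ℕ) : ℤ) + 1 = #T := by
    rw [hTn]; have : 1 ≤ n := by omega
    push_cast [Nat.cast_sub this]; ring
  rw [e] at hIH
  linarith

end RowOneBase

end Summit.CriticalPhenomena.PercolationContinuityZ3.Theorems.SahiCTCForms
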